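import Summits.CriticalPhenomena.PercolationContinuityZ3.Theorems.PercNearOneGluingNoHeavyQuantBlobAverageFloor
import HarnessLib

/-!
# QUANT lane R8, T-DEC: THE IDENTICAL GLUED TRIPLE `(R^r[q](R^k[g]))³` IS SDEC AT ITS TRUE FLOOR `q·g` — EVERY SHAPE `(r, k)`, ALL
# `0 < q, g < 1`, UNCONDITIONALLY (prim-quant-census-2 gen 80)

builds on p205010 (kernel theorem, internal audit signed; external expert review pending)

Support file (`--supports stmt-CriticalPhenomena-4575`), QUANT lane census seat prim-quant-census-2 (gen 80); memo
`run/shared/lean/prim/quant/prim-quant-census-2-g80/TRIPLE-G80.md`.  Theorems only, standard axioms, no sorries, no definitions.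

THE THEOREM (**`sdec_gluedThree_trueFloor`**).  `ρ = blobLaw [(k,g),(r,1)]` (a glued sibling: `r` sure relays and a `k`-blob at gate `g`),
`t = gate_q ρ`, `0 < q < 1`, `0 < g < 1`: `SDEC (q·g) (3(r+k)) (t ∗ t ∗ t)`.  Census-2 g79 had reduced this (`sdec_gluedThree_of_lift`) to two
unproved lift facts; census-1 g31/g32 have it for `K ≤ 2lo`; the generic width-3 step stops at `q²g` (`sdec_gluedThree_identical`).  Here: all shapes.

THE PROOF — an OUTER-GATE MIXTURE.  For an outer gate `a` put `m = aq`; the law `gate_a(t∗t∗t)` is a mixture of the root-count laws `ρ^{∗n}` with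
weights `(1−a)δ₀ + a·Bin(3,q)`, and it must be shown DEC at floor `m·g` at its mean `3m(r+kg)`.  It is the convex combination (**`gate_gluedThree_eq_mix_*`**)
  `α·gate_m(ρ∗ρ∗ρ) + β·(t_m ∗ t_m ∗ t_m) + δ·gate_{3m/2}(ρ∗ρ)`            (`m ≤ 2/3`),
  `α·gate_m(ρ∗ρ∗ρ) + β·(t_m ∗ t_m ∗ t_m) + γ·(ρ ∗ ρ ∗ gate_{3m−2} ρ)`      (`m > 2/3`),
with `β = (1−q)²/(1−m)²`, `δ = 2q(1−q)(1−a)/(1−m)`, `γ = mq(1−q)(1−a)/(1−m)²` and `α` the rest (all `≥ 0`: `q ≥ m`), every component having mean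
`3m(r+kg)`; and every component is DEC at floor `m·g` at every layer: `gate_m(ρ³)` and `gate_{3m/2}(ρ²)` are gated blob laws (`sdec_blobLaw`, floors
`g ≥ 2g/3`); `t_m³ = (t_m ∗ t_m) ∗ t_m` by `ConvClosedT` (`convClosedT_holds`) from `sdec_gluedTwo` and `sdec_gate` at their own means — the outer gate
is gone; and `ρ ∗ ρ ∗ gate_{3m−2} ρ` is the LIFT of `…QuantBlobAverageFloor` (`decAtT_twoSureOneGated`: floor `(2+c)g/3 = m·g` for `c = 3m−2`).
So the only "lift" the true floor needs is the polarized component of two sure copies and one gated copy, at outer gate `1` — where the three-blob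
average-gate certificate and the shift lemmas apply; no torque certificate, no budget split (both fail for long tails, memo §1).

HONEST STATUS.  Width 3, identical siblings, true floor: CLOSED for every shape.  Non-identical gates / widths ≥ 4 / `SiblingStep` / `FarTreeRow`
OPEN; RATE class (log\*) / honest sentence of `run/shared/lean/prim/quant/README.md` unchanged.  [this work].  Nothing here is cited as a
published result.  The gluing rows served [cite: KozmaNitzan2024, Conjecture 3 (p. 15)]; product measure [cite: Grimmett1999, §1.3 p. 10].
-/

noncomputable section

open scoped BigOperators

namespace Summit.CriticalPhenomena.PercolationContinuityZ3.Theorems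
namespace Quant
namespace LawDec

open Finset

/-! ### Expansions of gated products of one law in the basis `δ₀, ρ, ρ∗ρ, ρ∗ρ∗ρ` -/

/-- pair of gated copies: `gate_{c₁}ρ ∗ gate_{c₂}ρ = c₁c₂·ρ² + (c₁(1−c₂) + (1−c₁)c₂)·ρ + (1−c₁)(1−c₂)·δ₀`. [this work] -/
theorem gatedPair_expand (M : ℕ) (ρ : ℕ → ℝ) (hρM : ∀ h, M < h → ρ h = 0) (c₁ c₂ : ℝ) (h : ℕ) :
    lconv M M (gate ρ c₁) (gate ρ c₂) h
      = c₁ * c₂ * lconv M M ρ ρ h + (c₁ * (1 - c₂) + (1 - c₁) * c₂) * ρ h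
        + (1 - c₁) * (1 - c₂) * (if h = 0 then (1 : ℝ) else 0) := by
  have hgM : ∀ t, M < t → gate ρ c₂ t = 0 := fun t ht => by
    rw [gate_apply, hρM t ht, if_neg (by omega)]; ring
  rw [lconv_gate_left M M ρ _ c₁ hgM h, lconv_gate_right M M ρ ρ c₂ hρM h, gate_apply]
  ring

/-- triple of gated copies in the basis `ρ³, ρ², ρ, δ₀`. [this work] -/
theorem gatedTriple_expand (M : ℕ) (ρ : ℕ → ℝ) (hρM : ∀ h, M < h → ρ h = 0) (c₁ c₂ c₃ : ℝ) (h : ℕ) :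
    lconv (M + M) M (lconv M M (gate ρ c₁) (gate ρ c₂)) (gate ρ c₃) h
      = c₁ * c₂ * c₃ * lconv (M + M) M (lconv M M ρ ρ) ρ h
        + (c₃ * (c₁ * (1 - c₂) + (1 - c₁) * c₂) + (1 - c₃) * (c₁ * c₂)) * lconv M M ρ ρ h
        + (c₃ * ((1 - c₁) * (1 - c₂)) + (1 - c₃) * (c₁ * (1 - c₂) + (1 - c₁) * c₂)) * ρ h
        + (1 - c₃) * ((1 - c₁) * (1 - c₂)) * (if h = 0 then (1 : ℝ) else 0) := by
  have eP : lconv M M (gate ρ c₁) (gate ρ c₂) = fun h => c₁ * c₂ * lconv M M ρ ρ h + (c₁ * (1 - c₂) + (1 - c₁) * c₂) * ρ h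
      + (1 - c₁) * (1 - c₂) * (if h = 0 then (1 : ℝ) else 0) := funext (gatedPair_expand M ρ hρM c₁ c₂)
  have hPM : ∀ t, M + M < t → (fun h => c₁ * c₂ * lconv M M ρ ρ h + (c₁ * (1 - c₂) + (1 - c₁) * c₂) * ρ h
      + (1 - c₁) * (1 - c₂) * (if h = 0 then (1 : ℝ) else 0)) t = 0 := fun t ht => by
    simp only [lconv_eq_zero M M ρ ρ t ht, hρM t (by omega), if_neg (show t ≠ 0 by omega)]; ring
  rw [eP, lconv_gate_right (M + M) M _ ρ c₃ hPM h, lconv_lin3_left,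
    lconv_top_left_of_le M (M + M) M ρ ρ (by omega) hρM h, lconv_delta_left (M + M) M ρ hρM h]
  ring

/-! ### Law facts and SDEC of the powers of the glued sibling -/

/-- the blob lists of `ρ ∗ ρ` and `ρ ∗ ρ ∗ ρ` have all gates in `[g, 1]`. -/
theorem glued_lists_gates (r k : ℕ) {g : ℝ} (hg1 : g ≤ 1) :
    (∀ p ∈ ([(k, g), (r, (1 : ℝ))] ++ [(k, g), (r, 1)]), g ≤ p.2 ∧ p.2 ≤ 1) ∧
    (∀ p ∈ ([(k, g), (r, (1 : ℝ))] ++ ([(k, g), (r, 1)] ++ [(k, g), (r, 1)])), g ≤ p.2 ∧ p.2 ≤ 1) := by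
  have hL : ∀ p ∈ [((k : ℕ), g), (r, (1 : ℝ))], g ≤ p.2 ∧ p.2 ≤ 1 := by
    intro p hp
    simp only [List.mem_cons, List.mem_nil_iff, or_false] at hp
    rcases hp with rfl | rfl
    · exact ⟨le_rfl, hg1⟩
    · exact ⟨hg1, le_rfl⟩
  refine ⟨fun p hp => ?_, fun p hp => ?_⟩
  · rcases List.mem_append.1 hp with h | h <;> exact hL p h
  · rcases List.mem_append.1 hp with h | h
    · exact hL p h
    · rcases List.mem_append.1 h with h' | h' <;> exact hL p h'

/-- `ρ ∗ ρ` and `ρ ∗ ρ ∗ ρ` are blob laws (hence SDEC at `g`), with means `2(r+kg)`, `3(r+kg)`. [this work] -/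
theorem glued_powers_facts (r k : ℕ) {g : ℝ} (hg0 : 0 < g) (hg1 : g < 1) :
    let ρ := blobLaw [(k, g), (r, 1)]
    (∀ h, 0 ≤ lconv (r + k) (r + k) ρ ρ h) ∧ (∀ h, (r + k) + (r + k) < h → lconv (r + k) (r + k) ρ ρ h = 0) ∧
    (∑ h ∈ Finset.range ((r + k) + (r + k) + 1), lconv (r + k) (r + k) ρ ρ h = 1) ∧
    (∑ h ∈ Finset.range ((r + k) + (r + k) + 1), (h : ℝ) * lconv (r + k) (r + k) ρ ρ h = ((r : ℝ) + k * g) + ((r : ℝ) + k * g)) ∧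
    SDEC g ((r + k) + (r + k)) (lconv (r + k) (r + k) ρ ρ) ∧
    (∀ h, 0 ≤ lconv ((r + k) + (r + k)) (r + k) (lconv (r + k) (r + k) ρ ρ) ρ h) ∧
    (∀ h, (r + k) + (r + k) + (r + k) < h → lconv ((r + k) + (r + k)) (r + k) (lconv (r + k) (r + k) ρ ρ) ρ h = 0) ∧
    (∑ h ∈ Finset.range ((r + k) + (r + k) + (r + k) + 1), lconv ((r + k) + (r + k)) (r + k) (lconv (r + k) (r + k) ρ ρ) ρ h = 1) ∧
    (∑ h ∈ Finset.range ((r + k) + (r + k) + (r + k) + 1),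
        (h : ℝ) * lconv ((r + k) + (r + k)) (r + k) (lconv (r + k) (r + k) ρ ρ) ρ h
          = ((r : ℝ) + k * g) + ((r : ℝ) + k * g) + ((r : ℝ) + k * g)) ∧
    SDEC g ((r + k) + (r + k) + (r + k)) (lconv ((r + k) + (r + k)) (r + k) (lconv (r + k) (r + k) ρ ρ) ρ) := by
  intro ρ
  obtain ⟨a0, aM, a1, amn⟩ := glued_blob_laws r k hg0.le hg1.le
  obtain ⟨b0, bM, b1, bmn⟩ := lconv_laws a0 a1 amn a0 a1 amn
  obtain ⟨c0, cM, c1, cmn⟩ := lconv_laws b0 b1 bmn a0 a1 amn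
  obtain ⟨hl2, hl3⟩ := glued_lists_gates r k hg1.le
  have e2 : blobLaw ([(k, g), (r, (1 : ℝ))] ++ [(k, g), (r, 1)]) = lconv (r + k) (r + k) ρ ρ := by
    rw [blobLaw_append, blobTop_glued]
  have t2 : blobTop ([(k, g), (r, (1 : ℝ))] ++ [(k, g), (r, 1)]) = (r + k) + (r + k) := by
    rw [blobTop_append, blobTop_glued]
  have e3 : blobLaw ([(k, g), (r, (1 : ℝ))] ++ ([(k, g), (r, 1)] ++ [(k, g), (r, 1)]))
      = lconv ((r + k) + (r + k)) (r + k) (lconv (r + k) (r + k) ρ ρ) ρ := by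
    rw [blobLaw_append, e2, t2, blobTop_glued]
  have t3 : blobTop ([(k, g), (r, (1 : ℝ))] ++ ([(k, g), (r, 1)] ++ [(k, g), (r, 1)])) = (r + k) + (r + k) + (r + k) := by
    rw [blobTop_append, t2, blobTop_glued]
  have s2 := sdec_blobLaw g hg0 hg1 _ hl2
  rw [t2, e2] at s2
  have s3 := sdec_blobLaw g hg0 hg1 _ hl3
  rw [t3, e3] at s3
  exact ⟨b0, bM, b1, bmn, s2, c0, cM, c1, cmn, s3⟩

/-! ### The three auxiliary components are DEC at floor `m·g`, target `3m(r+kg)`, at every layer below `3(r+k)` -/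

/-- **component C**: `gate_m(ρ∗ρ∗ρ)`, a gated blob law. [this work] -/
theorem decAtT_comp_blob3 (r k : ℕ) {g m : ℝ} (hg0 : 0 < g) (hg1 : g < 1) (hm0 : 0 < m) (hm1 : m ≤ 1)
    (j : ℕ) (hj : j < (r + k) + (r + k) + (r + k)) :
    DECAtT (m * g) (3 * (m * ((r : ℝ) + k * g))) j ((r + k) + (r + k) + (r + k))
      (gate (lconv ((r + k) + (r + k)) (r + k) (lconv (r + k) (r + k) (blobLaw [(k, g), (r, 1)]) (blobLaw [(k, g), (r, 1)]))
        (blobLaw [(k, g), (r, 1)])) m) := by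
  obtain ⟨-, -, -, -, -, -, -, c1, cmn, s3⟩ := glued_powers_facts r k hg0 hg1
  have d := s3 m hm0 hm1 j hj
  rw [decAt_iff_decAtT, sum_mul_gate, cmn] at d
  have e : m * (((r : ℝ) + k * g) + ((r : ℝ) + k * g) + ((r : ℝ) + k * g)) = 3 * (m * ((r : ℝ) + k * g)) := by ring
  rwa [e] at d

/-- **component D**: `gate_{e}(ρ∗ρ)` with `e·2 = 3m`, `e ≤ 1` (used for `m ≤ 2/3`), via the floor `2g/3`. [this work] -/
theorem decAtT_comp_blob2 (r k : ℕ) {g m e : ℝ} (hg0 : 0 < g) (hg1 : g < 1) (hm0 : 0 < m) (he : 2 * e = 3 * m) (he1 : e ≤ 1)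
    (j : ℕ) :
    DECAtT (m * g) (3 * (m * ((r : ℝ) + k * g))) j ((r + k) + (r + k) + (r + k))
      (gate (lconv (r + k) (r + k) (blobLaw [(k, g), (r, 1)]) (blobLaw [(k, g), (r, 1)])) e) := by
  obtain ⟨b0, bM, b1, bmn, s2, -⟩ := glued_powers_facts r k hg0 hg1
  have he0 : 0 < e := by linarith
  have hx0 : 0 < 2 * g / 3 := by positivity
  have s2' : SDEC (2 * g / 3) ((r + k) + (r + k)) (lconv (r + k) (r + k) (blobLaw [(k, g), (r, 1)]) (blobLaw [(k, g), (r, 1)])) :=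
    sdec_mono s2 (by linarith) hg1
  have hr0 : (0 : ℝ) ≤ r := Nat.cast_nonneg r
  have hk0 : (0 : ℝ) ≤ k := Nat.cast_nonneg k
  have d : DECAt (e * (2 * g / 3)) j ((r + k) + (r + k))
      (gate (lconv (r + k) (r + k) (blobLaw [(k, g), (r, 1)]) (blobLaw [(k, g), (r, 1)])) e) := by
    by_cases hjM : j < (r + k) + (r + k)
    · exact s2' e he0 he1 j hjM
    · refine decAt_gate_of_top_le _ _ (2 * g / 3) e hx0.le (by nlinarith) he0.le he1 b0 bM b1 ?_ j (not_lt.1 hjM)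
      rw [bmn]; push_cast; nlinarith
  rw [decAt_iff_decAtT, sum_mul_gate, bmn] at d
  have ef : e * (2 * g / 3) = m * g := by linear_combination (g / 3) * he
  have eT : e * (((r : ℝ) + k * g) + ((r : ℝ) + k * g)) = 3 * (m * ((r : ℝ) + k * g)) := by linear_combination ((r : ℝ) + k * g) * he
  rw [ef, eT] at d
  exact decAtT_mono_top d (by omega)

/-- **component Bin3**: `t_m ∗ t_m ∗ t_m` (`t_m = gate_m ρ`, `0 < m < 1`) — `ConvClosedT` from the width-2 theorem and the single sibling at their own
means; no outer gate. [this work] -/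
theorem decAtT_comp_binomial (r k : ℕ) {g m : ℝ} (hg0 : 0 < g) (hg1 : g < 1) (hm0 : 0 < m) (hm1 : m < 1)
    (j : ℕ) (hj : j < (r + k) + (r + k) + (r + k)) :
    DECAtT (m * g) (3 * (m * ((r : ℝ) + k * g))) j ((r + k) + (r + k) + (r + k))
      (lconv ((r + k) + (r + k)) (r + k)
        (lconv (r + k) (r + k) (gate (blobLaw [(k, g), (r, 1)]) m) (gate (blobLaw [(k, g), (r, 1)]) m))
        (gate (blobLaw [(k, g), (r, 1)]) m)) := by
  obtain ⟨a0, aM, a1, amn⟩ := glued_blob_laws r k hg0.le hg1.le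
  obtain ⟨u0, uM, u1⟩ := gate_laws (r + k) _ m hm0.le hm1.le a0 aM a1
  obtain ⟨p0, pM, p1, pmn⟩ := lconv_laws u0 u1 (by rw [sum_mul_gate, amn]) u0 u1 (by rw [sum_mul_gate, amn])
  have hx0 : 0 < m * g := mul_pos hm0 hg0
  have hx1 : m * g < 1 := by nlinarith
  have hr0 : (0 : ℝ) ≤ r := Nat.cast_nonneg r
  have hk0 : (0 : ℝ) ≤ k := Nat.cast_nonneg k
  -- the single sibling at `m·g`
  have hρS : SDEC g (r + k) (blobLaw [(k, g), (r, 1)]) := by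
    have h := sdec_blobLaw g hg0 hg1 [((k : ℕ), g), (r, (1 : ℝ))] (fun p hp => by
      simp only [List.mem_cons, List.mem_nil_iff, or_false] at hp
      rcases hp with rfl | rfl
      · exact ⟨le_rfl, hg1.le⟩
      · exact ⟨hg1.le, le_rfl⟩)
    rwa [blobTop_glued] at h
  have d₂ : ∀ j'', DECAtT (m * g) (m * ((r : ℝ) + k * g)) j'' (r + k) (gate (blobLaw [(k, g), (r, 1)]) m) := by
    intro j''
    have d : DECAt (m * g) j'' (r + k) (gate (blobLaw [(k, g), (r, 1)]) m) := by
      by_cases hjM : j'' < r + k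
      · exact sdec_gate hρS m hm0 hm1.le 1 one_pos le_rfl j'' hjM |> fun h => by rwa [gate_one, one_mul] at h
      · exact decAt_gate_of_top_le (r + k) _ g m hg0.le hx1 hm0.le hm1.le a0 aM a1 (by rw [amn]; push_cast; nlinarith) j''
          (not_lt.1 hjM)
    rwa [decAt_iff_decAtT, sum_mul_gate, amn] at d
  -- the pair at `m·g` (width-2 theorem, outer gate 1)
  have hpair := sdec_gluedTwo r k r k hm0 hm1 hg0 hg1 hm0 hm1 hg0 hg1 hx0 le_rfl le_rfl
  have d₁ : ∀ j'', DECAtT (m * g) (m * ((r : ℝ) + k * g) + m * ((r : ℝ) + k * g)) j'' ((r + k) + (r + k))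
      (lconv (r + k) (r + k) (gate (blobLaw [(k, g), (r, 1)]) m) (gate (blobLaw [(k, g), (r, 1)]) m)) := by
    intro j''
    have d : DECAt (m * g) j'' ((r + k) + (r + k))
        (lconv (r + k) (r + k) (gate (blobLaw [(k, g), (r, 1)]) m) (gate (blobLaw [(k, g), (r, 1)]) m)) := by
      by_cases hjM : j'' < (r + k) + (r + k)
      · have h := hpair 1 one_pos le_rfl j'' hjM
        rwa [gate_one, one_mul] at h
      · refine decAt_of_top_le _ _ p0 pM p1 (m * g) hx1 (fun h hh => ?_) j'' (not_lt.1 hjM)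
        have hhM : h ≤ (r + k) + (r + k) := by
          by_contra hc
          exact absurd (pM h (not_le.1 hc)) hh.ne'
        have this : (h : ℝ) ≤ (((r + k) + (r + k) : ℕ) : ℝ) := by exact_mod_cast hhM
        rw [pmn]
        push_cast at this
        have h1 : m * g * (h : ℝ) ≤ m * g * (((r : ℝ) + k) + ((r : ℝ) + k)) := mul_le_mul_of_nonneg_left this hx0.le
        have h2 : m * (g * (r : ℝ)) ≤ m * r := mul_le_mul_of_nonneg_left (mul_le_of_le_one_left hr0 hg1.le) hm0.le
        linarith
    rwa [decAt_iff_decAtT, pmn] at d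
  have hC := convClosedT_holds (m * g) _ _ ((r + k) + (r + k)) (r + k) j _ _ hx0 hx1 p0 pM p1 u0 uM u1 hj
    (fun j'' _ _ => d₁ j'') (fun j'' _ _ => d₂ j'')
  have e : m * ((r : ℝ) + k * g) + m * ((r : ℝ) + k * g) + m * ((r : ℝ) + k * g) = 3 * (m * ((r : ℝ) + k * g)) := by ring
  rwa [e] at hC

/-- **component X**: `ρ ∗ ρ ∗ gate_{3m−2} ρ` for `2/3 < m < 1` — the lift of `…QuantBlobAverageFloor`. [this work] -/
theorem decAtT_comp_lift (r k : ℕ) {g m : ℝ} (hg0 : 0 < g) (hg1 : g < 1) (hm : 2 / 3 < m) (hm1 : m ≤ 1) (j : ℕ) :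
    DECAtT (m * g) (3 * (m * ((r : ℝ) + k * g))) j ((r + k) + (r + k) + (r + k))
      (lconv ((r + k) + (r + k)) (r + k) (lconv (r + k) (r + k) (blobLaw [(k, g), (r, 1)]) (blobLaw [(k, g), (r, 1)]))
        (gate (blobLaw [(k, g), (r, 1)]) (3 * m - 2))) := by
  have d := decAtT_twoSureOneGated r k hg0 hg1 (by linarith : 0 < 3 * m - 2) (by linarith : 3 * m - 2 ≤ 1) j
  have e1 : (2 + (3 * m - 2)) * g / 3 = m * g := by ring
  have e2 : (2 + (3 * m - 2)) * ((r : ℝ) + k * g) = 3 * (m * ((r : ℝ) + k * g)) := by ring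
  rwa [e1, e2] at d


/-! ### The outer-gate mixture identities -/

/-- **MIXTURE, `m = aq ≤ 2/3`**: `gate_a(t_q³) = α·gate_m(ρ³) + β·t_m³ + δ·gate_{3m/2}(ρ²)` with `β = (1−q)²/(1−m)²`, `δ = 2q(1−q)(1−a)/(1−m)`,
`α = q² − m²β` (an identity of root-count mixtures; `m ≠ 1`). [this work] -/
theorem gate_gluedThree_eq_mix_low (M : ℕ) (ρ : ℕ → ℝ) (hρM : ∀ h, M < h → ρ h = 0) (a q : ℝ) (hm : 1 - a * q ≠ 0) (h : ℕ) :
    gate (lconv (M + M) M (lconv M M (gate ρ q) (gate ρ q)) (gate ρ q)) a h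
      = (q ^ 2 - (a * q) ^ 2 * ((1 - q) ^ 2 / (1 - a * q) ^ 2)) * gate (lconv (M + M) M (lconv M M ρ ρ) ρ) (a * q) h
        + ((1 - q) ^ 2 / (1 - a * q) ^ 2) * lconv (M + M) M (lconv M M (gate ρ (a * q)) (gate ρ (a * q))) (gate ρ (a * q)) h
        + (2 * q * (1 - q) * (1 - a) / (1 - a * q)) * gate (lconv M M ρ ρ) (3 * (a * q) / 2) h := by
  rw [gate_apply, gate_apply, gate_apply, gatedTriple_expand M ρ hρM q q q h, gatedTriple_expand M ρ hρM (a * q) (a * q) (a * q) h]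
  field_simp
  ring

/-- **MIXTURE, `m = aq > 2/3`**: `gate_a(t_q³) = α·gate_m(ρ³) + β·t_m³ + γ·(ρ ∗ ρ ∗ gate_{3m−2} ρ)` with `β = (1−q)²/(1−m)²`,
`γ = mq(1−q)(1−a)/(1−m)²`, `α = 1 − β − γ`. [this work] -/
theorem gate_gluedThree_eq_mix_high (M : ℕ) (ρ : ℕ → ℝ) (hρM : ∀ h, M < h → ρ h = 0) (a q : ℝ) (hm : 1 - a * q ≠ 0) (h : ℕ) :
    gate (lconv (M + M) M (lconv M M (gate ρ q) (gate ρ q)) (gate ρ q)) a h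
      = (1 - (1 - q) ^ 2 / (1 - a * q) ^ 2 - a * q * q * (1 - q) * (1 - a) / (1 - a * q) ^ 2)
          * gate (lconv (M + M) M (lconv M M ρ ρ) ρ) (a * q) h
        + ((1 - q) ^ 2 / (1 - a * q) ^ 2) * lconv (M + M) M (lconv M M (gate ρ (a * q)) (gate ρ (a * q))) (gate ρ (a * q)) h
        + (a * q * q * (1 - q) * (1 - a) / (1 - a * q) ^ 2) * lconv (M + M) M (lconv M M ρ ρ) (gate ρ (3 * (a * q) - 2)) h := by
  have hρ2M : ∀ t, M + M < t → lconv M M ρ ρ t = 0 := fun t ht => lconv_eq_zero M M ρ ρ t ht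
  rw [gate_apply, gate_apply, gatedTriple_expand M ρ hρM q q q h, gatedTriple_expand M ρ hρM (a * q) (a * q) (a * q) h,
    lconv_gate_right (M + M) M _ ρ (3 * (a * q) - 2) hρ2M h]
  field_simp
  ring

/-! ### The identical glued triple at its true floor -/

/-- **THE IDENTICAL GLUED TRIPLE IS SDEC AT ITS TRUE FLOOR — EVERY SHAPE.**  `ρ = blobLaw [(k,g),(r,1)]`, `t = gate_q ρ`, `0 < q < 1`,
`0 < g < 1`: `SDEC (q·g) (3(r+k)) ((t ∗ t) ∗ t)`.  For each outer gate `a` (`m = aq`) the law `gate_a(t³)` is the mixture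
`gate_gluedThree_eq_mix_low/high` of components each DEC at floor `m·g`, target `3m(r+kg)`: `decAtT_comp_blob3`, `decAtT_comp_binomial`,
`decAtT_comp_blob2` (`m ≤ 2/3`) / `decAtT_comp_lift` (`m > 2/3`, the lift of `…QuantBlobAverageFloor`). [this work] -/
theorem sdec_gluedThree_trueFloor (r k : ℕ) {q g : ℝ} (hq0 : 0 < q) (hq1 : q < 1) (hg0 : 0 < g) (hg1 : g < 1) :
    SDEC (q * g) ((r + k) + (r + k) + (r + k))
      (lconv ((r + k) + (r + k)) (r + k)
        (lconv (r + k) (r + k) (gate (blobLaw [(k, g), (r, 1)]) q) (gate (blobLaw [(k, g), (r, 1)]) q))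
        (gate (blobLaw [(k, g), (r, 1)]) q)) := by
  intro a ha0 ha1 j hj
  set ρ : ℕ → ℝ := blobLaw [(k, g), (r, 1)] with hρ
  have hm0 : 0 < a * q := mul_pos ha0 hq0
  have hmq : a * q ≤ q := by nlinarith
  have hm1 : a * q < 1 := lt_of_le_of_lt hmq hq1
  have hmne : 1 - a * q ≠ 0 := by linarith
  have hmne' : 1 - q * a ≠ 0 := by rwa [mul_comm] at hmne
  have hβ0 : 0 ≤ (1 - q) ^ 2 / (1 - a * q) ^ 2 := div_nonneg (sq_nonneg _) (sq_nonneg _)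
  -- laws and the mean of the gated triple
  obtain ⟨a0, aM, a1, amn⟩ := glued_blob_laws r k hg0.le hg1.le
  obtain ⟨u0, uM, u1⟩ := gate_laws (r + k) ρ q hq0.le hq1.le a0 aM a1
  have umn : ∑ h ∈ Finset.range (r + k + 1), (h : ℝ) * gate ρ q h = q * ((r : ℝ) + k * g) := by rw [sum_mul_gate, amn]
  obtain ⟨p0, pM, p1, pmn⟩ := lconv_laws u0 u1 umn u0 u1 umn
  obtain ⟨t0, tM, t1, tmn⟩ := lconv_laws p0 p1 pmn u0 u1 umn
  rw [decAt_iff_decAtT, sum_mul_gate, tmn]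
  have eT : a * (q * ((r : ℝ) + k * g) + q * ((r : ℝ) + k * g) + q * ((r : ℝ) + k * g)) = 3 * ((a * q) * ((r : ℝ) + k * g)) := by ring
  have ex : a * (q * g) = (a * q) * g := by ring
  rw [eT, ex]
  -- the common components
  have hC := decAtT_comp_blob3 r k hg0 hg1 hm0 hm1.le j hj
  have hB := decAtT_comp_binomial r k hg0 hg1 hm0 hm1 j hj
  by_cases hcase : a * q ≤ 2 / 3
  · -- the mixture with the gated pair of sure copies
    have hD := decAtT_comp_blob2 r k hg0 hg1 hm0 (e := 3 * (a * q) / 2) (by ring) (by linarith) j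
    have hα0 : 0 ≤ q ^ 2 - (a * q) ^ 2 * ((1 - q) ^ 2 / (1 - a * q) ^ 2) := by
      have h1 : a * q * (1 - q) ≤ q * (1 - a * q) := by nlinarith
      have h2 : (a * q * (1 - q)) ^ 2 ≤ (q * (1 - a * q)) ^ 2 :=
        pow_le_pow_left₀ (mul_nonneg hm0.le (by linarith)) h1 2
      have hpos : 0 < (1 - a * q) ^ 2 := by positivity
      rw [sub_nonneg, ← mul_div_assoc, div_le_iff₀ hpos]
      nlinarith
    have hδ0 : 0 ≤ 2 * q * (1 - q) * (1 - a) / (1 - a * q) :=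
      div_nonneg (mul_nonneg (mul_nonneg (by positivity) (by linarith)) (by linarith)) (by linarith)
    refine decAtT_finite_mixture (ι := Fin 3) _ _ j _ _
      ![q ^ 2 - (a * q) ^ 2 * ((1 - q) ^ 2 / (1 - a * q) ^ 2), (1 - q) ^ 2 / (1 - a * q) ^ 2,
        2 * q * (1 - q) * (1 - a) / (1 - a * q)]
      ![gate (lconv ((r + k) + (r + k)) (r + k) (lconv (r + k) (r + k) ρ ρ) ρ) (a * q),
        lconv ((r + k) + (r + k)) (r + k) (lconv (r + k) (r + k) (gate ρ (a * q)) (gate ρ (a * q))) (gate ρ (a * q)),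
        gate (lconv (r + k) (r + k) ρ ρ) (3 * (a * q) / 2)]
      ?_ ?_ (fun h => ?_) ?_
    · intro i; fin_cases i
      · exact hα0
      · exact hβ0
      · exact hδ0
    · rw [Fin.sum_univ_three]
      show q ^ 2 - (a * q) ^ 2 * ((1 - q) ^ 2 / (1 - a * q) ^ 2) + (1 - q) ^ 2 / (1 - a * q) ^ 2
        + 2 * q * (1 - q) * (1 - a) / (1 - a * q) = 1
      field_simp
      ring
    · rw [Fin.sum_univ_three]
      exact gate_gluedThree_eq_mix_low (r + k) ρ aM a q hmne h
    · intro i hi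
      fin_cases i
      · exact hC
      · exact hB
      · exact hD
  · -- the mixture with the lift `ρ ∗ ρ ∗ gate_{3m−2} ρ`
    have hcase' : 2 / 3 < a * q := lt_of_not_ge hcase
    have hX := decAtT_comp_lift r k hg0 hg1 hcase' hm1.le j
    have hγ0 : 0 ≤ a * q * q * (1 - q) * (1 - a) / (1 - a * q) ^ 2 :=
      div_nonneg (mul_nonneg (mul_nonneg (mul_nonneg hm0.le hq0.le) (by linarith)) (by linarith)) (sq_nonneg _)
    have hα0 : 0 ≤ 1 - (1 - q) ^ 2 / (1 - a * q) ^ 2 - a * q * q * (1 - q) * (1 - a) / (1 - a * q) ^ 2 := by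
      have hpos : 0 < (1 - a * q) ^ 2 := by positivity
      have key : (1 - q) ^ 2 + a * q * q * (1 - q) * (1 - a) ≤ (1 - a * q) ^ 2 := by
        nlinarith [mul_nonneg (mul_nonneg hq0.le (by linarith : 0 ≤ 1 - a)) (by nlinarith : 0 ≤ 2 - q - 2 * a * q + a * q ^ 2),
          mul_nonneg hq0.le (by linarith : 0 ≤ 1 - a)]
      have e : 1 - (1 - q) ^ 2 / (1 - a * q) ^ 2 - a * q * q * (1 - q) * (1 - a) / (1 - a * q) ^ 2
          = ((1 - a * q) ^ 2 - ((1 - q) ^ 2 + a * q * q * (1 - q) * (1 - a))) / (1 - a * q) ^ 2 := by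
        field_simp
        ring
      rw [e]
      exact div_nonneg (by linarith) hpos.le
    refine decAtT_finite_mixture (ι := Fin 3) _ _ j _ _
      ![1 - (1 - q) ^ 2 / (1 - a * q) ^ 2 - a * q * q * (1 - q) * (1 - a) / (1 - a * q) ^ 2, (1 - q) ^ 2 / (1 - a * q) ^ 2,
        a * q * q * (1 - q) * (1 - a) / (1 - a * q) ^ 2]
      ![gate (lconv ((r + k) + (r + k)) (r + k) (lconv (r + k) (r + k) ρ ρ) ρ) (a * q),
        lconv ((r + k) + (r + k)) (r + k) (lconv (r + k) (r + k) (gate ρ (a * q)) (gate ρ (a * q))) (gate ρ (a * q)),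
        lconv ((r + k) + (r + k)) (r + k) (lconv (r + k) (r + k) ρ ρ) (gate ρ (3 * (a * q) - 2))]
      ?_ ?_ (fun h => ?_) ?_
    · intro i; fin_cases i
      · exact hα0
      · exact hβ0
      · exact hγ0
    · rw [Fin.sum_univ_three]
      show 1 - (1 - q) ^ 2 / (1 - a * q) ^ 2 - a * q * q * (1 - q) * (1 - a) / (1 - a * q) ^ 2 + (1 - q) ^ 2 / (1 - a * q) ^ 2
        + a * q * q * (1 - q) * (1 - a) / (1 - a * q) ^ 2 = 1
      ring
    · rw [Fin.sum_univ_three]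
      exact gate_gluedThree_eq_mix_high (r + k) ρ aM a q hmne h
    · intro i hi
      fin_cases i
      · exact hC
      · exact hB
      · exact hX

end LawDec
end Quant
end Summit.CriticalPhenomena.PercolationContinuityZ3.Theorems
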